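import Summits.NavierStokesRegularity.NavierStokesRegularity.Theorems.PeepholeVorticityDoorCoreDefs

/-!
# PeepholeVorticityDoorUpperXY — door S29 «PeepholeVorticityDoor», FILE 2: Stub B2 `UpperXYS29` (upper bounds for Tao's `X` and `Y` from sup bounds and the peephole bound at `s = 0`)

Plate of record: nsreg-p1 g23 `r27/UpperXYB2.lean` sha16 d3df2f46f003295e (farm rc 0 · 0 sorry; refuter1 g9 K-65 PASS: statement IDENTICAL to
`r27/Skeleton29.lean` a83afe48495060f1), re-based by ns-s29-p2 g2 on `PeepholeVorticityDoorCoreDefs` (the §1 quantities and the stub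
text `UpperXYS29` are imported from there, local copies dropped; proof bodies untouched; DIRECTOR-NS #135 (b)).

Generic upper bounds for Tao's `X` and `Y` (second Carleman inequality, Prop. 4.3 of Tao 2021) from sup bounds on the
cylinder and an `ε'`-bound at `s = 0` on `B(0, r_p')` (split `B(0,r)` at `|y| = r_p'`; Gaussian mass `∫_{ℝ³} t₁^{−3/2}e^{−|y|²/4t₁} = (4π)^{3/2}`;
`|B_r| = vB·r³`).  The two `ContinuousOn` hypotheses are not used (right sides are `≥ 0`, so the Bochner junk value is harmless) —
kept for the statement of record.

Closes `theorem upperXYS29_holds : UpperXYS29` — one of the six hypotheses of `peepholeToCore_of_stubs`.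
WHAT THIS IS NOT: not NS regularity; not `NoTypeII` (stmt-0056 OPEN); analytic bookkeeping for a HYPOTHETICAL-blow-up door.
-/

noncomputable section

set_option linter.dupNamespace false

open MeasureTheory Set Filter Topology Metric Function
open scoped Topology ENNReal

namespace Summit.NavierStokesRegularity.NavierStokesRegularity.Theorems.PeepholeVorticityDoor

/-! ## helpers -/

/-- `|B(0,r)| = vB · r³` in `ℝ³`. -/
theorem volumeReal_ball_eq {r : ℝ} (hr : 0 < r) :
    volume.real (ball (0 : EuclideanSpace ℝ (Fin 3)) r) = vB * r ^ 3 := by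
  rw [measureReal_def, Measure.addHaar_ball_of_pos volume _ hr, finrank_euclideanSpace_fin, ENNReal.toReal_mul,
    ENNReal.toReal_ofReal (by positivity), vB, mul_comm]

/-- `∫_{ℝ³} e^{−|y|²/4t₁} dy = (4π t₁)^{3/2}`. -/
theorem integral_gaussian_scale {t₁ : ℝ} (ht₁ : 0 < t₁) :
    ∫ y : EuclideanSpace ℝ (Fin 3), Real.exp (-‖y‖ ^ 2 / (4 * t₁)) = (4 * Real.pi * t₁) ^ ((3 : ℝ) / 2) := by
  have h := GaussianFourier.integral_rexp_neg_mul_sq_norm (V := EuclideanSpace ℝ (Fin 3)) (b := 1 / (4 * t₁))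
    (by positivity)
  have e : (fun y : EuclideanSpace ℝ (Fin 3) => Real.exp (-(1 / (4 * t₁)) * ‖y‖ ^ 2)) =
      fun y => Real.exp (-‖y‖ ^ 2 / (4 * t₁)) := by
    funext y; congr 1; ring
  rw [e] at h
  rw [h, finrank_euclideanSpace_fin]
  have : Real.pi / (1 / (4 * t₁)) = 4 * Real.pi * t₁ := by field_simp
  rw [this]
  norm_num

/-- the heat kernel profile `e^{−|y|²/4t₁}` is integrable on `ℝ³`. -/
theorem integrable_gaussian_scale {t₁ : ℝ} (ht₁ : 0 < t₁) :
    Integrable fun y : EuclideanSpace ℝ (Fin 3) => Real.exp (-‖y‖ ^ 2 / (4 * t₁)) := by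
  refine Integrable.of_integral_ne_zero ?_
  rw [integral_gaussian_scale ht₁]
  positivity

/-- `∫_{B(0,r)} t₁^{−3/2} e^{−|y|²/4t₁} dy ≤ (4π)^{3/2}`. -/
theorem setIntegral_gaussianScale_le {t₁ r : ℝ} (ht₁ : 0 < t₁) :
    ∫ y in ball (0 : EuclideanSpace ℝ (Fin 3)) r, t₁ ^ (-(3 : ℝ) / 2) * Real.exp (-‖y‖ ^ 2 / (4 * t₁)) ≤
      (4 * Real.pi) ^ ((3 : ℝ) / 2) := by
  have hint := (integrable_gaussian_scale ht₁).const_mul (t₁ ^ (-(3 : ℝ) / 2))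
  calc ∫ y in ball (0 : EuclideanSpace ℝ (Fin 3)) r, t₁ ^ (-(3 : ℝ) / 2) * Real.exp (-‖y‖ ^ 2 / (4 * t₁))
      ≤ ∫ y : EuclideanSpace ℝ (Fin 3), t₁ ^ (-(3 : ℝ) / 2) * Real.exp (-‖y‖ ^ 2 / (4 * t₁)) :=
        setIntegral_le_integral hint (Eventually.of_forall fun y => by positivity)
    _ = (4 * Real.pi) ^ ((3 : ℝ) / 2) := by
        rw [integral_const_mul, integral_gaussian_scale ht₁, Real.mul_rpow (by positivity) ht₁.le, ← mul_assoc,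
          mul_comm (t₁ ^ (-(3 : ℝ) / 2)), mul_assoc, ← Real.rpow_add ht₁]
        norm_num

/-! ## Stub B2 -/

/-- **Stub B2** `UpperXYS29` holds. -/
theorem upperXYS29_holds : UpperXYS29 := by
  intro U Tp r t₁ M₁ M₂ ε' rp' hTp hr ht₁ hM₁ hM₂ hε' hrp' _hcU _hcDU hsup hpeep
  have hvol := volumeReal_ball_eq hr
  have hvB : 0 ≤ vB := ENNReal.toReal_nonneg
  refine ⟨?_, ?_⟩
  · -- the `X` bound
    have hF : ∀ s ∈ Icc (0 : ℝ) Tp,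
        ∫ y in ball (0 : EuclideanSpace ℝ (Fin 3)) r, (Tp⁻¹ * ‖U s y‖ ^ 2 + ‖fderiv ℝ (U s) y‖ ^ 2) ≤
          (vB * r ^ 3) * (Tp⁻¹ * M₁ ^ 2 + M₂ ^ 2) := by
      intro s hs
      have hle : ∫ y in ball (0 : EuclideanSpace ℝ (Fin 3)) r, (Tp⁻¹ * ‖U s y‖ ^ 2 + ‖fderiv ℝ (U s) y‖ ^ 2) ≤
          ∫ _ in ball (0 : EuclideanSpace ℝ (Fin 3)) r, (Tp⁻¹ * M₁ ^ 2 + M₂ ^ 2) := by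
        refine integral_mono_of_nonneg (Eventually.of_forall fun y => by positivity) (integrableOn_const ?_) ?_
        · exact measure_ball_lt_top.ne
        · refine (ae_restrict_iff' measurableSet_ball).2 (Eventually.of_forall fun y hy => ?_)
          obtain ⟨h1, h2⟩ := hsup s hs y (ball_subset_closedBall hy)
          have h1' : ‖U s y‖ ^ 2 ≤ M₁ ^ 2 := pow_le_pow_left₀ (norm_nonneg _) h1 2
          have h2' : ‖fderiv ℝ (U s) y‖ ^ 2 ≤ M₂ ^ 2 := pow_le_pow_left₀ (norm_nonneg _) h2 2
          have hTi : 0 ≤ Tp⁻¹ := by positivity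
          nlinarith
      refine hle.trans (le_of_eq ?_)
      rw [setIntegral_const, hvol, smul_eq_mul]
    unfold cX
    rw [intervalIntegral.integral_of_le hTp.le]
    calc ∫ s in Ioc (0 : ℝ) Tp, ∫ y in ball (0 : EuclideanSpace ℝ (Fin 3)) r, (Tp⁻¹ * ‖U s y‖ ^ 2 + ‖fderiv ℝ (U s) y‖ ^ 2)
        ≤ ∫ _ in Ioc (0 : ℝ) Tp, (vB * r ^ 3) * (Tp⁻¹ * M₁ ^ 2 + M₂ ^ 2) := by
          refine integral_mono_of_nonneg (Eventually.of_forall fun s => integral_nonneg fun y => by positivity)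
            (integrableOn_const ?_) ?_
          · exact (measure_Ioc_lt_top).ne
          · exact (ae_restrict_iff' measurableSet_Ioc).2 (Eventually.of_forall fun s hs => hF s (Ioc_subset_Icc_self hs))
      _ = Tp * (vB * r ^ 3) * (Tp⁻¹ * M₁ ^ 2 + M₂ ^ 2) := by
          rw [setIntegral_const, smul_eq_mul, Real.volume_real_Ioc_of_le hTp.le, sub_zero]; ring
  · -- the `Y` bound
    set g : EuclideanSpace ℝ (Fin 3) → ℝ := fun y => t₁ ^ (-(3 : ℝ) / 2) * Real.exp (-‖y‖ ^ 2 / (4 * t₁)) with hgdef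
    set Cst : ℝ := M₁ ^ 2 * (t₁ ^ (-(3 : ℝ) / 2) * Real.exp (-rp' ^ 2 / (4 * t₁))) with hCstdef
    have hg0 : ∀ y, 0 ≤ g y := fun y => by rw [hgdef]; positivity
    have hCst : 0 ≤ Cst := by rw [hCstdef]; positivity
    have ht32 : 0 < t₁ ^ (-(3 : ℝ) / 2) := Real.rpow_pos_of_pos ht₁ _
    have hgint : Integrable g := (integrable_gaussian_scale ht₁).const_mul _
    have hle : ∀ y ∈ ball (0 : EuclideanSpace ℝ (Fin 3)) r, ‖U 0 y‖ ^ 2 * g y ≤ ε' ^ 2 * g y + Cst := by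
      intro y hy
      by_cases hyp : ‖y‖ < rp'
      · have h1 : ‖U 0 y‖ ≤ ε' := hpeep y (mem_ball_zero_iff.2 hyp)
        have h1' : ‖U 0 y‖ ^ 2 ≤ ε' ^ 2 := pow_le_pow_left₀ (norm_nonneg _) h1 2
        nlinarith [hg0 y, mul_le_mul_of_nonneg_right h1' (hg0 y)]
      · rw [not_lt] at hyp
        have h1 : ‖U 0 y‖ ≤ M₁ := (hsup 0 ⟨le_rfl, hTp.le⟩ y (ball_subset_closedBall hy)).1
        have h1' : ‖U 0 y‖ ^ 2 ≤ M₁ ^ 2 := pow_le_pow_left₀ (norm_nonneg _) h1 2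
        have h2 : g y ≤ t₁ ^ (-(3 : ℝ) / 2) * Real.exp (-rp' ^ 2 / (4 * t₁)) := by
          rw [hgdef]
          apply mul_le_mul_of_nonneg_left _ ht32.le
          apply Real.exp_le_exp.2
          rw [neg_div, neg_div, neg_le_neg_iff]
          apply div_le_div_of_nonneg_right _ (by positivity)
          exact pow_le_pow_left₀ hrp'.le hyp 2
        have h3 : ‖U 0 y‖ ^ 2 * g y ≤ Cst := by
          rw [hCstdef]; exact mul_le_mul h1' h2 (hg0 y) (sq_nonneg _)
        nlinarith [hg0 y, sq_nonneg ε']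
    have hgi : IntegrableOn (fun y => ε' ^ 2 * g y + Cst) (ball (0 : EuclideanSpace ℝ (Fin 3)) r) :=
      (hgint.const_mul _).integrableOn.add (integrableOn_const measure_ball_lt_top.ne)
    unfold cY
    calc ∫ y in ball (0 : EuclideanSpace ℝ (Fin 3)) r, ‖U 0 y‖ ^ 2 * (t₁ ^ (-(3 : ℝ) / 2) * Real.exp (-‖y‖ ^ 2 / (4 * t₁)))
        ≤ ∫ y in ball (0 : EuclideanSpace ℝ (Fin 3)) r, (ε' ^ 2 * g y + Cst) :=
          integral_mono_of_nonneg (Eventually.of_forall fun y => mul_nonneg (sq_nonneg _) (hg0 y)) hgi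
            ((ae_restrict_iff' measurableSet_ball).2 (Eventually.of_forall hle))
      _ = ε' ^ 2 * (∫ y in ball (0 : EuclideanSpace ℝ (Fin 3)) r, g y) + Cst * (vB * r ^ 3) := by
          rw [integral_add (hgint.const_mul _).integrableOn (integrableOn_const measure_ball_lt_top.ne),
            integral_const_mul, setIntegral_const, hvol, smul_eq_mul, mul_comm (vB * r ^ 3)]
      _ ≤ ε' ^ 2 * (4 * Real.pi) ^ ((3 : ℝ) / 2) + M₁ ^ 2 * (vB * r ^ 3) * (t₁ ^ (-(3 : ℝ) / 2) * Real.exp (-rp' ^ 2 / (4 * t₁))) := by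
          have hI : ∫ y in ball (0 : EuclideanSpace ℝ (Fin 3)) r, g y ≤ (4 * Real.pi) ^ ((3 : ℝ) / 2) :=
            setIntegral_gaussianScale_le (r := r) ht₁
          have h2 : Cst * (vB * r ^ 3) =
              M₁ ^ 2 * (vB * r ^ 3) * (t₁ ^ (-(3 : ℝ) / 2) * Real.exp (-rp' ^ 2 / (4 * t₁))) := by
            rw [hCstdef]; ring
          rw [h2]
          exact add_le_add_left (mul_le_mul_of_nonneg_left hI (sq_nonneg ε')) _

end Summit.NavierStokesRegularity.NavierStokesRegularity.Theorems.PeepholeVorticityDoor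

end
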